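import Mathlib.Analysis.SpecialFunctions.Pow.Deriv
import Mathlib.MeasureTheory.Integral.IntervalIntegral.Basic
import Literature.NumberTheory.Transcendental.KZIntervalPeriodProofs
import Literature.NumberTheory.Transcendental.KZPeriodsProofs
import HarnessLib

/-!
# The elliptic integrands along a root-to-root segment are Kontsevich–Zagier periods

Topic `Literature/NumberTheory/Transcendental` (family `periods`). Third step of the discharge of
the named facts `Literature.NumberTheory.Transcendental.isPeriod_η₂` / `isPeriod_η₁` /
`isPeriod_of_mem_lattice` of `KontsevichZagier.lean` (Kontsevich–Zagier 2001, §1.1: the elliptic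
integrals `∫ dx/y`, `-∫ x dx/y` on `y² = f(x) = 4x³ - g₂x - g₃` over `ℚ̄` are periods).

For two roots `a ≠ b` of `f` with algebraic `a, b, g₂, g₃` and no third root on the closed
segment `[a, b]` (in the form `ℓ(s) = (b - a)s + 2a + b ≠ 0` on `(0, 1)`; recall
`f(a + s(b - a)) = 4(b - a)² s(s - 1)ℓ(s)`), we fix the **algebraic branch**

  `y(s) = ν · √(f(a + s(b - a)) / ν²)`,  `ν = √f(a + (b - a)/2)`  (principal square roots),

of `√f` along the segment. Since `f(a + s(b - a))/ν² = 4s(1 - s) · ℓ(s)/ℓ(1/2)` and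
`ℓ(s)/ℓ(1/2)` never meets the closed negative real axis for `s ∈ (0, 1)` (otherwise `ℓ` would
vanish at a point of `(0, 1)`), the radicand stays in the slit plane, so `y` is differentiable on
`(0, 1)` with `y² = f(x(s))` (`sq_ellipticBranch`, `differentiableAt_ellipticBranch`): these are
exactly the hypotheses of the segment lift (`exists_segmentLift`,
`KontsevichZagierEllipticLift.lean`). The real and imaginary parts of the integrands
`(b - a)/y(s)` and `x(s)(b - a)/y(s)` are `ℚ`-semialgebraic functions of `s ∈ (0, 1)` (the
calculus of `KZSemialgebraicComplex.lean`: real-algebraic constants, `+`, `*`, `/`, `√`), hence —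
granted absolute convergence, which the lift file proves — both integrals over `[0, 1]` are
Kontsevich–Zagier periods (the tree's `isPeriod_intervalIntegral`, `KZIntervalPeriodProofs.lean`:
`∫₀¹ h` with `re h`, `im h` semialgebraic and `h` integrable is a period, via
`KZ.isRealPeriod_iff_exists_integralRep_holds` — Kontsevich–Zagier's remark that algebraic
integrands are allowed). Main statement: `isPeriod_ellipticIntegrals_segment`.

## References

* M. Kontsevich, D. Zagier, *Periods* (2001), §1.1 (Definition, the remark after it, and the
  list of examples: elliptic integrals).
* A. Huber, S. Müller-Stach, *Periods and Nori Motives* (2017), §12.2.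

## Design notes

Theorems only; no definitions (the branch is written out in the statements), no named facts.
-/

noncomputable section

open Complex Set MeasureTheory intervalIntegral MvPolynomial
open Literature.ModelTheory.ExponentialFields

namespace Literature.NumberTheory.Transcendental

/-! ### The algebraic branch of `√f` along a segment -/

/-- The principal square root is complex-differentiable on the slit plane. [folklore] -/
theorem differentiableAt_sqrt {z : ℂ} (hz : z ∈ slitPlane) : DifferentiableAt ℂ Complex.sqrt z := by
  have h := (Complex.hasStrictDerivAt_cpow_const (c := (2⁻¹ : ℂ)) hz).hasDerivAt.differentiableAt
  exact h

/-- **The rotation trick.** If `ℓ(s) = ds + e` (affine, complex) has no zero on `(0, 1)`, then for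
`s ∈ (0, 1)` the ratio `ℓ(s)/ℓ(1/2)` lies in the slit plane `ℂ ∖ (-∞, 0]`: if
`ℓ(s) = -t ℓ(1/2)` with `t ≥ 0` then `ℓ` vanishes at `(s + t/2)/(1 + t) ∈ (0, 1)`. [folklore] -/
theorem div_mem_slitPlane_of_affine {d e : ℂ} (h : ∀ s ∈ Ioo (0 : ℝ) 1, d * s + e ≠ 0) {s : ℝ}
    (hs : s ∈ Ioo (0 : ℝ) 1) : (d * s + e) / (d * (1 / 2 : ℝ) + e) ∈ slitPlane := by
  have hhalf : (1 / 2 : ℝ) ∈ Ioo (0 : ℝ) 1 := ⟨by norm_num, by norm_num⟩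
  have h0 : d * (1 / 2 : ℝ) + e ≠ 0 := h _ hhalf
  rw [mem_slitPlane_iff]
  by_contra hcon
  simp only [not_or, not_lt, not_not] at hcon
  obtain ⟨hre, him⟩ := hcon
  set z := (d * s + e) / (d * (1 / 2 : ℝ) + e) with hz
  -- `z = -t` with `t ≥ 0`
  set t : ℝ := -z.re with ht
  have ht0 : 0 ≤ t := by rw [ht]; linarith
  have hzt : z = -(t : ℂ) := by
    apply Complex.ext <;> simp [ht, him]
  have key : d * s + e = -(t : ℂ) * (d * (1 / 2 : ℝ) + e) := by
    rw [← hzt, hz, div_mul_cancel₀ _ h0]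
  -- hence `ℓ((s + t/2)/(1+t)) = 0`
  have h1t : (0 : ℝ) < 1 + t := by linarith
  have hu : (s + t / 2) / (1 + t) ∈ Ioo (0 : ℝ) 1 := by
    constructor
    · exact div_pos (by linarith [hs.1]) h1t
    · rw [div_lt_one h1t]; linarith [hs.2]
  apply h _ hu
  have h1t' : (1 + (t : ℂ)) ≠ 0 := by exact_mod_cast h1t.ne'
  have key2 : d * ((s : ℂ) + t / 2) + e * (1 + t) = 0 := by
    push_cast at key
    linear_combination key
  have e2 : d * (((s + t / 2) / (1 + t) : ℝ) : ℂ) + e =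
      (d * ((s : ℂ) + t / 2) + e * (1 + t)) / (1 + t) := by
    push_cast
    field_simp
  rw [e2, key2, zero_div]

/-- **The algebraic branch is a square root of `f` along the segment.** With
`P(s) = f(a + s(b - a))` and `ν = √P(1/2)`, the function `y(s) = ν √(P(s)/ν²)` satisfies
`y(s)² = P(s)` (for every `s` at which `P(1/2) ≠ 0` is used only to cancel). [folklore] -/
theorem sq_ellipticBranch {g₂ g₃ a b : ℂ} {s : ℝ}
    (hν : 4 * (a + (1 / 2 : ℝ) * (b - a)) ^ 3 - g₂ * (a + (1 / 2 : ℝ) * (b - a)) - g₃ ≠ 0) :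
    (Complex.sqrt (4 * (a + (1 / 2 : ℝ) * (b - a)) ^ 3 - g₂ * (a + (1 / 2 : ℝ) * (b - a)) - g₃) *
        Complex.sqrt ((4 * (a + s * (b - a)) ^ 3 - g₂ * (a + s * (b - a)) - g₃) /
          Complex.sqrt (4 * (a + (1 / 2 : ℝ) * (b - a)) ^ 3 -
            g₂ * (a + (1 / 2 : ℝ) * (b - a)) - g₃) ^ 2)) ^ 2 =
      4 * (a + s * (b - a)) ^ 3 - g₂ * (a + s * (b - a)) - g₃ := by
  have sqrt_sq_eq : ∀ z : ℂ, Complex.sqrt z ^ 2 = z := fun z => by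
    rw [Complex.sqrt, show (2⁻¹ : ℂ) = ((2 : ℕ) : ℂ)⁻¹ by norm_num]
    exact Complex.cpow_nat_inv_pow z two_ne_zero
  rw [mul_pow, sqrt_sq_eq, sqrt_sq_eq, mul_div_cancel₀ _ hν]

/-- **The algebraic branch is differentiable on the open segment.** If `a, b` are roots of `f`
and `ℓ(s) = (b - a)s + 2a + b` has no zero on `(0, 1)`, then
`s ↦ ν √(f(a + s(b - a))/ν²)`, `ν = √f(a + (b - a)/2)`, is (real-)differentiable at every
`s ∈ (0, 1)`: the radicand equals `4s(1 - s) ℓ(s)/ℓ(1/2)`, which lies in the slit plane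
(`div_mem_slitPlane_of_affine`), where the principal square root is holomorphic. [folklore] -/
theorem differentiableAt_ellipticBranch {g₂ g₃ a b : ℂ}
    (ha : 4 * a ^ 3 - g₂ * a - g₃ = 0) (hb : 4 * b ^ 3 - g₂ * b - g₃ = 0) (hab : a ≠ b)
    (hℓ : ∀ s ∈ Ioo (0 : ℝ) 1, (b - a) * s + (2 * a + b) ≠ 0) {s : ℝ} (hs : s ∈ Ioo (0 : ℝ) 1) :
    DifferentiableAt ℝ (fun s : ℝ =>
      Complex.sqrt (4 * (a + (1 / 2 : ℝ) * (b - a)) ^ 3 - g₂ * (a + (1 / 2 : ℝ) * (b - a)) - g₃) *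
        Complex.sqrt ((4 * (a + s * (b - a)) ^ 3 - g₂ * (a + s * (b - a)) - g₃) /
          Complex.sqrt (4 * (a + (1 / 2 : ℝ) * (b - a)) ^ 3 -
            g₂ * (a + (1 / 2 : ℝ) * (b - a)) - g₃) ^ 2)) s := by
  have sqrt_sq_eq : ∀ z : ℂ, Complex.sqrt z ^ 2 = z := fun z => by
    rw [Complex.sqrt, show (2⁻¹ : ℂ) = ((2 : ℕ) : ℂ)⁻¹ by norm_num]
    exact Complex.cpow_nat_inv_pow z two_ne_zero
  set d : ℂ := b - a with hd
  have hd0 : d ≠ 0 := sub_ne_zero.2 (Ne.symm hab)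
  have hfac : ∀ z : ℂ, 4 * (a + z * d) ^ 3 - g₂ * (a + z * d) - g₃ =
      4 * d ^ 2 * z * (z - 1) * (d * z + (2 * a + b)) := fun z => by
    rw [hd]; linear_combination z * hb + (1 - z) * ha
  set ν : ℂ := Complex.sqrt (4 * (a + (1 / 2 : ℝ) * d) ^ 3 - g₂ * (a + (1 / 2 : ℝ) * d) - g₃)
    with hνdef
  have hhalf : (1 / 2 : ℝ) ∈ Ioo (0 : ℝ) 1 := ⟨by norm_num, by norm_num⟩
  have hν2 : ν ^ 2 = 4 * d ^ 2 * (1 / 2 : ℝ) * ((1 / 2 : ℝ) - 1) * (d * (1 / 2 : ℝ) + (2 * a + b)) := by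
    rw [hνdef, sqrt_sq_eq, hfac]
  have hν0 : ν ^ 2 ≠ 0 := by
    rw [hν2]
    refine mul_ne_zero (mul_ne_zero (mul_ne_zero (mul_ne_zero (by norm_num) (pow_ne_zero 2 hd0))
      (by norm_num)) (by norm_num)) (hℓ _ hhalf)
  -- the radicand as a holomorphic function of a complex variable
  set R : ℂ → ℂ := fun z => (4 * (a + z * d) ^ 3 - g₂ * (a + z * d) - g₃) / ν ^ 2 with hR
  have hRdiff : Differentiable ℂ R := by
    simp only [hR]
    fun_prop (disch := exact hν0)
  -- its value at `s` lies in the slit plane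
  have hRs : R s ∈ slitPlane := by
    have e : R s = ((4 * s * (1 - s) : ℝ) : ℂ) *
        ((d * s + (2 * a + b)) / (d * (1 / 2 : ℝ) + (2 * a + b))) := by
      simp only [hR]
      rw [hfac, hν2]
      have h0 : d * (1 / 2 : ℝ) + (2 * a + b) ≠ 0 := hℓ _ hhalf
      field_simp
      push_cast
      ring
    rw [e]
    have hpos : (0 : ℝ) < 4 * s * (1 - s) := by nlinarith [hs.1, hs.2]
    have hz := div_mem_slitPlane_of_affine hℓ hs
    rw [mem_slitPlane_iff] at hz ⊢
    simp only [Complex.re_ofReal_mul, Complex.im_ofReal_mul]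
    rcases hz with hz | hz
    · exact Or.inl (mul_pos hpos hz)
    · exact Or.inr (mul_ne_zero hpos.ne' hz)
  -- differentiate `ν √(R z)` at `z = s` and restrict to the real line
  have hG : DifferentiableAt ℂ (fun z : ℂ => ν * Complex.sqrt (R z)) (s : ℂ) :=
    (((differentiableAt_sqrt hRs).comp (s : ℂ) (hRdiff (s : ℂ))).const_mul ν)
  have h := hG.hasDerivAt.comp_ofReal
  exact h.differentiableAt

/-! ### Semialgebraicity of the integrands -/

/-- The real and imaginary parts of the algebraic branch `y(s) = ν √(f(x(s))/ν²)` are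
`ℚ`-semialgebraic functions of `s` on any `ℚ`-semialgebraic `σ ⊆ ℝ¹` (algebraic data
`a, b - a, g₂, g₃, ν`). [cite: KontsevichZagier2001, §1.1] -/
theorem re_im_ellipticBranch {σ : Set (Fin 1 → ℝ)} (hσ : IsSemialgebraic ℚ σ) {a d g₂ g₃ ν : ℂ}
    (ha : IsAlgebraic ℚ a) (hd : IsAlgebraic ℚ d) (hg₂ : IsAlgebraic ℚ g₂) (hg₃ : IsAlgebraic ℚ g₃)
    (hν : IsAlgebraic ℚ ν) :
    IsSemialgebraicFunOn ℚ σ (fun u => (ν * Complex.sqrt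
        ((4 * (a + (u 0 : ℂ) * d) ^ 3 - g₂ * (a + (u 0 : ℂ) * d) - g₃) / ν ^ 2)).re) ∧
      IsSemialgebraicFunOn ℚ σ (fun u => (ν * Complex.sqrt
        ((4 * (a + (u 0 : ℂ) * d) ^ 3 - g₂ * (a + (u 0 : ℂ) * d) - g₃) / ν ^ 2)).im) := by
  have cst : ∀ {c : ℂ}, IsAlgebraic ℚ c →
      IsSemialgebraicFunOn ℚ σ (fun _ => c.re) ∧ IsSemialgebraicFunOn ℚ σ (fun _ => c.im) :=
    fun hc => re_im_const hσ (isAlgebraic_re_im hc).1 (isAlgebraic_re_im hc).2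
  have hX := re_im_add (cst ha) (re_im_mul (re_im_coord hσ) (cst hd))
  have h4 : IsAlgebraic ℚ (4 : ℂ) := isAlgebraic_nat 4
  have hP := re_im_sub (re_im_sub (re_im_mul (cst h4) (re_im_pow hσ hX 3))
    (re_im_mul (cst hg₂) hX)) (cst hg₃)
  by_cases hν0 : ν = 0
  · subst hν0
    refine ⟨?_, ?_⟩
    · simpa using isSemialgebraicFunOn_natCast (k := ℚ) (R := ℝ) hσ 0
    · simpa using isSemialgebraicFunOn_natCast (k := ℚ) (R := ℝ) hσ 0
  have hQ := re_im_div hP (re_im_pow hσ (cst hν) 2) (fun _ _ => pow_ne_zero 2 hν0)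
  exact re_im_mul (cst hν) (re_im_sqrt hQ)

/-! ### The two elliptic integrals along the segment are periods -/

/-- **The elliptic integrals of the first and second kind along a root-to-root segment are
Kontsevich–Zagier periods.** Let `a ≠ b` be algebraic roots of `f(x) = 4x³ - g₂x - g₃` with
`g₂, g₃` algebraic, and let `y(s) = ν √(f(a + s(b - a))/ν²)`, `ν = √f(a + (b - a)/2)` be the
algebraic branch of `√f` along the segment. If the integrals `∫₀¹ (b - a) ds/y` ("`∫ₐᵇ dx/y`")
and `∫₀¹ x(s)(b - a) ds/y` ("`∫ₐᵇ x dx/y`") converge absolutely, they are periods: their real and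
imaginary parts are integrals over the `ℚ`-semialgebraic set `(0, 1) ⊆ ℝ¹` of `ℚ`-semialgebraic
functions (algebraic integrands and coefficients being allowed by
`KZ.isRealPeriod_iff_exists_integralRep_holds`). [Kontsevich–Zagier 2001, §1.1: elliptic
integrals among the examples of periods] [cite: KontsevichZagier2001, §1.1] -/
theorem isPeriod_ellipticIntegrals_segment {g₂ g₃ a b : ℂ} (hg₂ : IsAlgebraic ℚ g₂)
    (hg₃ : IsAlgebraic ℚ g₃) (ha : IsAlgebraic ℚ a) (hb : IsAlgebraic ℚ b)
    (haR : 4 * a ^ 3 - g₂ * a - g₃ = 0) (hbR : 4 * b ^ 3 - g₂ * b - g₃ = 0) (hab : a ≠ b)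
    (hℓ : ∀ s ∈ Ioo (0 : ℝ) 1, (b - a) * s + (2 * a + b) ≠ 0)
    (hint₁ : IntervalIntegrable (fun s : ℝ => (b - a) /
      (Complex.sqrt (4 * (a + (1 / 2 : ℝ) * (b - a)) ^ 3 - g₂ * (a + (1 / 2 : ℝ) * (b - a)) - g₃) *
        Complex.sqrt ((4 * (a + s * (b - a)) ^ 3 - g₂ * (a + s * (b - a)) - g₃) /
          Complex.sqrt (4 * (a + (1 / 2 : ℝ) * (b - a)) ^ 3 -
            g₂ * (a + (1 / 2 : ℝ) * (b - a)) - g₃) ^ 2))) volume 0 1)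
    (hint₂ : IntervalIntegrable (fun s : ℝ => (a + s * (b - a)) * (b - a) /
      (Complex.sqrt (4 * (a + (1 / 2 : ℝ) * (b - a)) ^ 3 - g₂ * (a + (1 / 2 : ℝ) * (b - a)) - g₃) *
        Complex.sqrt ((4 * (a + s * (b - a)) ^ 3 - g₂ * (a + s * (b - a)) - g₃) /
          Complex.sqrt (4 * (a + (1 / 2 : ℝ) * (b - a)) ^ 3 -
            g₂ * (a + (1 / 2 : ℝ) * (b - a)) - g₃) ^ 2))) volume 0 1) :
    IsPeriod (∫ s in (0 : ℝ)..1, (b - a) /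
      (Complex.sqrt (4 * (a + (1 / 2 : ℝ) * (b - a)) ^ 3 - g₂ * (a + (1 / 2 : ℝ) * (b - a)) - g₃) *
        Complex.sqrt ((4 * (a + s * (b - a)) ^ 3 - g₂ * (a + s * (b - a)) - g₃) /
          Complex.sqrt (4 * (a + (1 / 2 : ℝ) * (b - a)) ^ 3 -
            g₂ * (a + (1 / 2 : ℝ) * (b - a)) - g₃) ^ 2))) ∧
    IsPeriod (∫ s in (0 : ℝ)..1, (a + s * (b - a)) * (b - a) /
      (Complex.sqrt (4 * (a + (1 / 2 : ℝ) * (b - a)) ^ 3 - g₂ * (a + (1 / 2 : ℝ) * (b - a)) - g₃) *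
        Complex.sqrt ((4 * (a + s * (b - a)) ^ 3 - g₂ * (a + s * (b - a)) - g₃) /
          Complex.sqrt (4 * (a + (1 / 2 : ℝ) * (b - a)) ^ 3 -
            g₂ * (a + (1 / 2 : ℝ) * (b - a)) - g₃) ^ 2))) := by
  set d : ℂ := b - a with hd
  set ν : ℂ := Complex.sqrt (4 * (a + (1 / 2 : ℝ) * d) ^ 3 - g₂ * (a + (1 / 2 : ℝ) * d) - g₃)
    with hνdef
  have hdalg : IsAlgebraic ℚ d := hb.sub ha
  have hhalf : IsAlgebraic ℚ (((1 / 2 : ℝ) : ℂ)) := by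
    rw [show (((1 / 2 : ℝ) : ℂ)) = ((1 / 2 : ℚ) : ℂ) by push_cast; ring]
    exact isAlgebraic_algebraMap _
  have sqrt_sq_eq : ∀ z : ℂ, Complex.sqrt z ^ 2 = z := fun z => by
    rw [Complex.sqrt, show (2⁻¹ : ℂ) = ((2 : ℕ) : ℂ)⁻¹ by norm_num]
    exact Complex.cpow_nat_inv_pow z two_ne_zero
  have hνalg : IsAlgebraic ℚ ν :=
    isAlgebraic_of_sq_eq ((((isAlgebraic_nat 4).mul ((ha.add (hhalf.mul hdalg)).pow 3)).sub
      (hg₂.mul (ha.add (hhalf.mul hdalg)))).sub hg₃) (by rw [hνdef, sqrt_sq_eq]; norm_num)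
  set σ : Set (Fin 1 → ℝ) := {u | 0 < u 0 ∧ u 0 < 1} with hσ
  have hY := re_im_ellipticBranch isSemialgebraic_unitInterval_fin_one ha hdalg hg₂ hg₃ hνalg
  have cst : ∀ {c : ℂ}, IsAlgebraic ℚ c →
      IsSemialgebraicFunOn ℚ σ (fun _ => c.re) ∧ IsSemialgebraicFunOn ℚ σ (fun _ => c.im) :=
    fun hc => re_im_const isSemialgebraic_unitInterval_fin_one (isAlgebraic_re_im hc).1 (isAlgebraic_re_im hc).2
  have hX := re_im_add (cst ha) (re_im_mul (re_im_coord isSemialgebraic_unitInterval_fin_one) (cst hdalg))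
  -- the branch does not vanish on `(0, 1)`
  have hd0 : d ≠ 0 := sub_ne_zero.2 (Ne.symm hab)
  have hhalfI : (1 / 2 : ℝ) ∈ Ioo (0 : ℝ) 1 := ⟨by norm_num, by norm_num⟩
  have hfac : ∀ z : ℂ, 4 * (a + z * d) ^ 3 - g₂ * (a + z * d) - g₃ =
      4 * d ^ 2 * z * (z - 1) * (d * z + (2 * a + b)) := fun z => by
    rw [hd]; linear_combination z * hbR + (1 - z) * haR
  have hP0 : ∀ s ∈ Ioo (0 : ℝ) 1, 4 * (a + s * d) ^ 3 - g₂ * (a + s * d) - g₃ ≠ 0 := by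
    intro s hs
    rw [hfac]
    have h1 : (s : ℂ) ≠ 0 := by exact_mod_cast hs.1.ne'
    have h2 : (s : ℂ) - 1 ≠ 0 := sub_ne_zero.2 (by exact_mod_cast hs.2.ne)
    exact mul_ne_zero (mul_ne_zero (mul_ne_zero (mul_ne_zero (by norm_num) (pow_ne_zero 2 hd0))
      h1) h2) (hℓ s hs)
  have hνP : 4 * (a + (1 / 2 : ℝ) * d) ^ 3 - g₂ * (a + (1 / 2 : ℝ) * d) - g₃ ≠ 0 := hP0 _ hhalfI
  have h0 : ∀ u ∈ σ, ν * Complex.sqrt ((4 * (a + (u 0 : ℂ) * d) ^ 3 -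
      g₂ * (a + (u 0 : ℂ) * d) - g₃) / ν ^ 2) ≠ 0 := by
    intro u hu h
    have hsq := sq_ellipticBranch (g₂ := g₂) (g₃ := g₃) (a := a) (b := b) (s := u 0) hνP
    rw [h] at hsq
    exact hP0 (u 0) hu (by simpa using hsq.symm)
  have hF₁ := re_im_div (cst hdalg) hY h0
  have hF₂ := re_im_div (re_im_mul hX (cst hdalg)) hY h0
  exact ⟨isPeriod_intervalIntegral hF₁.1 hF₁.2
      ((intervalIntegrable_iff_integrableOn_Ioo_of_le zero_le_one).1 hint₁),
    isPeriod_intervalIntegral hF₂.1 hF₂.2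
      ((intervalIntegrable_iff_integrableOn_Ioo_of_le zero_le_one).1 hint₂)⟩

end Literature.NumberTheory.Transcendental
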